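import Literature.NumberTheory.Automorphic.UnramifiedOrbitalUnitFactor
import Literature.NumberTheory.Rogawski1990.MatchingAdeleGKConjHolds
import HarnessLib

/-!
# The unramified local unit factors `Φ_v(γ_v, 1_{K_v}) = 1` a.e. at a SEMISIMPLE (possibly SINGULAR) rational class, from the a.e.
# `K_v`-conjugacy hypothesis — the regularity-free twin of ★ `UnramifiedOrbitalUnitFactor`
(Kottwitz, *Stable trace formula: elliptic singular terms* (1986), Prop. 7.1, Cor. 7.3; Rogawski, *Automorphic representations of unitary groups
in three variables* (1990), §3.3 p. 21, §4.3 p. 44, §5.4 p. 72 (print))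

Topic `NumberTheory/Automorphic`; namespaces `Literature.MeasureTheory.Group` (§1, generic) and `Literature.NumberTheory.Automorphic.UnitaryGroup`
(§2–§5).  THEOREMS ONLY: no definition, no instance, no notation, no named fact, no `sorry`.  Cell `hodgecm-mathlib`, floor 0, ENGINE T1
(crux `H413`, stmt-HodgeConjecture-24833), row O7 ∕ K6-β of CENSUS-O7 v3 (A-p01 (g15)) «the SINGULAR∕SEMISIMPLE twin of ★ `UnramifiedOrbitSetAE`
:135 ∕ ★ `eventually_classOrbitalIntegral_indicator_eq_one` :190» (F0P3a-plan (g5) RULING #108 (2)); seat F0P5-p04 (g5).  HC_CM is proved only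
modulo the printed citations until rung 0 closes; this file discharges none of them.

WHY.  ★ `UnitaryGroup.UnramifiedOrbitSetAE L N H` (Kottwitz's orbit lemma «`y γ_v y⁻¹ ∈ K_v ⇒ y ∈ K_v · Z(γ_v)` a.e.») and its consequences
in ★ `UnramifiedOrbitalUnitFactor` §3 (a.e. `Φ_v([γ_v], 1_{K_v}) = (mG v).atPoint γ_v (π K_v)`, a.e. `= 1` under `IsNormalisedOff`, the finite
exceptional set `S₂ ⊇ T.S`, the `hf1`-free orbital Euler product) are typed for REGULAR semisimple `γ` (`IsRegularElt`); the singular semisimple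
classes of the elliptic stabilisation (CENSUS-O7 v3 §1 K6) need them WITHOUT that guard.  Prop. 7.1 at `v` is EQUIVALENT to the `K_v`-CONJUGACY
statement «every `g′ ∈ K_v` conjugate to `γ_v` is `K_v`-conjugate to it» (§1; a `U(H)(L⁺_v)`-conjugate is a `GL_N(L ⊗ L⁺_v)`-conjugate, so the
`GL`-gated clause of K6-α feeds it); a.e. in `v` this is the output of the companion row K6-α (A-p01 (g15)) at a semisimple `γ`, and ★ today at a
REGULAR `γ` (`Rogawski1990.eventually_forall_integralConj_cmDatum`, §5).  This file takes it as a HYPOTHESIS BINDER `hKγ` (shape (KC): no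
regularity, no semisimplicity, no hermitian clause) and proves every consequence of ★ §3 from it — independent of K6-α's proof, consumed by the
singular Euler assembly K6-δ as ★ §3 is by ★ `AdelicStableOrbitalEulerDischarge` :141 ∕ ★ `AdelicKappaOrbitalEulerDischargeGp` :129 at regular classes.

THE HYPOTHESIS SHAPE (KC) at a rational `γ ∈ U(H)(L⁺)` (`γ_v := toLocal v (toAdelic γ)`, `K_v := cmLocalIntegralLevel L N H v`):
  `∀ᶠ v in cofinite, ∀ g′ : U(H)(L⁺_v), g′ ∈ K_v → IsConj (g′.val : GL_N(L ⊗ L⁺_v)) (γ_v.val) → ∃ k ∈ K_v, k * γ_v * k⁻¹ = g′`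
(`IsConj` of the values in `GL_N(L ⊗ L⁺_v)` = ★ `Corresponds` unfolded — O7 OWNER WORD #1 (A) (A-p01 (g15)): the K6-α OUTPUT clause VERBATIM at the
fixed `γ` = ★ `eventually_forall_integralConj_cmDatum`'s conclusion with the charpoly antecedent replaced by conjugacy over the local ring, the right
currency at a singular `γ`, where «same charpoly» ⇏ «conjugate»).  THE ORBIT-SET SHAPE (OS) at `γ`: the body of ★ `UnramifiedOrbitSetAE` at `γ`
verbatim, `∀ᶠ v in cofinite, ∀ y, y * γ_v * y⁻¹ ∈ K_v → y ∈ K_v * Z(γ_v)`.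

* §1 (generic group): `mem_mul_centralizer_of_forall_isConj` ((KC) ⇒ (OS) pointwise), `exists_mem_conj_eq_of_orbitSet` (converse), `orbitSet_iff_forall_isConj`.
* §2 (CM dress, any `N`, any `H`): **`eventually_orbitSet_of_eventually_integralConj`** ((KC) ⇒ (OS) a.e.).
* §3 from (OS) at `γ`, no `IsRegularElt` (proofs of ★ §3 verbatim, `hK γ hγ` ↦ the binder): **`eventually_classOrbitalIntegral_indicator_eq_atPoint_of_orbitSet`**,
  **`…_indicator_eq_one_of_orbitSet`**, **`exists_finset_forall_classOrbitalIntegral_loc_eq_one_of_orbitSet`**, headline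
  **`exists_finset_adelicClassOrbitalIntegral_ofLocal_eval_eq_mul_prod_of_orbitSet`** (`H` anisotropic, ANY rational class, `hf1`-free Euler product).
* §4 the same four from (KC) at `γ` (the K6-α socket): `…_of_integralConj`.
* §5 (KC) holds TODAY at every REGULAR `γ` for hermitian non-degenerate `H`: **`eventually_integralConj_of_isRegularElt`** (★
  `eventually_forall_integralConj_cmDatum` + Mathlib `Matrix.charpoly_units_conj`); §2 ∘ §5 is then ★ `unramifiedOrbitSetAE_of_hermitian` again (not restated).

## References
* R. E. Kottwitz, *Stable trace formula: elliptic singular terms*, Math. Ann. 275 (1986), §7, Prop. 7.1, Cor. 7.3 [Kottwitz1986].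
* J. D. Rogawski, *Automorphic Representations of Unitary Groups in Three Variables*, Ann. of Math. Stud. 123 (1990), §3.3 p. 21, §4.3 p. 44,
  §5.4 p. 72 (print) [Rogawski1990].
-/

set_option autoImplicit false

noncomputable section

open MeasureTheory Measure Set Filter Topology NumberField IsDedekindDomain
open scoped ENNReal NNReal Pointwise Matrix

/-! ## §1 Kottwitz's orbit set `⊆ K · Z(γ₀)` ⟺ `K`-conjugacy of the `K`-members of the `G`-orbit of `γ₀` -/

namespace Literature.MeasureTheory.Group

section OrbitSetConj

variable {G : Type*} [Group G] (γ₀ : G) (K : Subgroup G)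

/-- **`K`-conjugacy ⇒ orbit set**: if every `g′ ∈ K` conjugate to `γ₀` is conjugate to it BY AN ELEMENT OF `K`, then every `y` with
`y γ₀ y⁻¹ ∈ K` lies in `K · Z(γ₀)` (take `g′ := y γ₀ y⁻¹ = k γ₀ k⁻¹`; then `k⁻¹ y ∈ Z(γ₀)`). [cite: Kottwitz1986, Prop. 7.1] -/
theorem mem_mul_centralizer_of_forall_isConj
    (h : ∀ g' : G, g' ∈ K → IsConj γ₀ g' → ∃ k ∈ K, k * γ₀ * k⁻¹ = g') (y : G) (hy : y * γ₀ * y⁻¹ ∈ K) :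
    y ∈ (K : Set G) * (Subgroup.centralizer ({γ₀} : Set G) : Set G) := by
  obtain ⟨k, hk, hkeq⟩ := h (y * γ₀ * y⁻¹) hy (isConj_iff.2 ⟨y, rfl⟩)
  have hz : k⁻¹ * y ∈ Subgroup.centralizer ({γ₀} : Set G) := by
    rw [Subgroup.mem_centralizer_singleton_iff]
    have h1 : γ₀ * k⁻¹ = k⁻¹ * (y * γ₀ * y⁻¹) := by
      rw [← hkeq, ← mul_assoc, ← mul_assoc, inv_mul_cancel, one_mul]
    symm
    calc γ₀ * (k⁻¹ * y) = γ₀ * k⁻¹ * y := (mul_assoc _ _ _).symm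
      _ = k⁻¹ * (y * γ₀ * y⁻¹) * y := by rw [h1]
      _ = k⁻¹ * y * γ₀ := by simp only [mul_assoc, inv_mul_cancel, mul_one]
  have hy' : y = k * (k⁻¹ * y) := (mul_inv_cancel_left k y).symm
  rw [hy']
  exact Set.mul_mem_mul hk hz

/-- **Orbit set ⇒ `K`-conjugacy**: if every `y` with `y γ₀ y⁻¹ ∈ K` lies in `K · Z(γ₀)`, then every `g′ ∈ K` conjugate to `γ₀` is
`K`-conjugate to it (`g′ = y γ₀ y⁻¹`, `y = k z` ⇒ `g′ = k γ₀ k⁻¹`). [cite: Kottwitz1986, Prop. 7.1] -/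
theorem exists_mem_conj_eq_of_orbitSet
    (h : ∀ y : G, y * γ₀ * y⁻¹ ∈ K → y ∈ (K : Set G) * (Subgroup.centralizer ({γ₀} : Set G) : Set G))
    (g' : G) (hg' : g' ∈ K) (hc : IsConj γ₀ g') : ∃ k ∈ K, k * γ₀ * k⁻¹ = g' := by
  obtain ⟨y, rfl⟩ := isConj_iff.1 hc
  obtain ⟨k, hk, z, hz, hyz⟩ := Set.mem_mul.1 (h y hg')
  refine ⟨k, hk, ?_⟩
  have hzc : z * γ₀ = γ₀ * z := Subgroup.mem_centralizer_singleton_iff.1 hz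
  rw [← hyz]
  calc k * γ₀ * k⁻¹ = k * (z * γ₀ * z⁻¹) * k⁻¹ := by rw [hzc, mul_inv_cancel_right]
    _ = k * z * γ₀ * (k * z)⁻¹ := by simp only [mul_assoc, mul_inv_rev]

/-- **Kottwitz's orbit-set statement ⟺ `K`-conjugacy of the `K`-members of the orbit** (§1 packaged). [cite: Kottwitz1986, Prop. 7.1] -/
theorem orbitSet_iff_forall_isConj :
    (∀ y : G, y * γ₀ * y⁻¹ ∈ K → y ∈ (K : Set G) * (Subgroup.centralizer ({γ₀} : Set G) : Set G)) ↔
      ∀ g' : G, g' ∈ K → IsConj γ₀ g' → ∃ k ∈ K, k * γ₀ * k⁻¹ = g' :=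
  ⟨fun h g' hg' hc => exists_mem_conj_eq_of_orbitSet γ₀ K h g' hg' hc,
    fun h y hy => mem_mul_centralizer_of_forall_isConj γ₀ K h y hy⟩

end OrbitSetConj

end Literature.MeasureTheory.Group

/-! ## §2 The CM dress: a.e. `K_v`-conjugacy (KC) at `γ` ⇒ the a.e. orbit set (OS) at `γ` -/

namespace Literature.NumberTheory.Automorphic

namespace UnitaryGroup

open Literature.MeasureTheory.Group
open Literature.NumberTheory.Rogawski1990
open Literature.AlgebraicGeometry.ShimuraVarieties (hermForm)

section CM

variable (L : Type) [Field L] [NumberField L] [IsCMField L] (N : ℕ) (H : Matrix (Fin N) (Fin N) L)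

/-- **(KC) ⇒ (OS) at almost every place** — for ANY rational `γ ∈ U(H)(L⁺)` (no regularity, no semisimplicity): if for all but finitely many
`v` every `g′ ∈ K_v = U(H)(𝒪_v)` conjugate to `γ_v` in `GL_N(L ⊗ L⁺_v)` is `K_v`-conjugate to it (the K6-α clause, O7 OWNER WORD #1 (A)), then for all
but finitely many `v` every `y` with `y γ_v y⁻¹ ∈ K_v` lies in `K_v · Z(γ_v)` — the body of ★ `UnramifiedOrbitSetAE L N H` at `γ` (§1 along the
inclusion `U(H)(L⁺_v) ≤ GL_N(L ⊗ L⁺_v)`, Mathlib `MonoidHom.map_isConj`). [cite: Kottwitz1986, Prop. 7.1; Cor. 7.3]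
[cite: Rogawski1990, §3.3 p. 21] -/
theorem eventually_orbitSet_of_eventually_integralConj (γ : (cmDatum L N H).Rational)
    (hKγ : ∀ᶠ v : HeightOneSpectrum (𝓞 ↥(maximalRealSubfield L)) in Filter.cofinite,
      ∀ g' : (cmDatum L N H).Local v, g' ∈ cmLocalIntegralLevel L N H v →
        IsConj (g'.val : GL (Fin N) (LocalRing L v))
          (((cmDatum L N H).toLocal v ((cmDatum L N H).toAdelic γ)).val : GL (Fin N) (LocalRing L v)) →
          ∃ k ∈ cmLocalIntegralLevel L N H v, k * (cmDatum L N H).toLocal v ((cmDatum L N H).toAdelic γ) * k⁻¹ = g') :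
    ∀ᶠ v : HeightOneSpectrum (𝓞 ↥(maximalRealSubfield L)) in Filter.cofinite,
      ∀ y : (cmDatum L N H).Local v,
        y * (cmDatum L N H).toLocal v ((cmDatum L N H).toAdelic γ) * y⁻¹ ∈ cmLocalIntegralLevel L N H v →
          y ∈ (cmLocalIntegralLevel L N H v : Set ((cmDatum L N H).Local v)) *
            (Subgroup.centralizer ({(cmDatum L N H).toLocal v ((cmDatum L N H).toAdelic γ)} : Set ((cmDatum L N H).Local v)) :
              Set ((cmDatum L N H).Local v)) :=
  hKγ.mono fun v hv y hy =>
    mem_mul_centralizer_of_forall_isConj _ _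
      (fun g' hg' hc => hv g' hg' (((«local» L (IsCMField.complexConj L) N H v).subtype.map_isConj hc).symm)) y hy

end CM

/-! ## §3 Consequences of the a.e. orbit set (OS) at `γ`: the unit factors, regularity-free -/

section UnitFactor

variable (L : Type) [Field L] [NumberField L] [IsCMField L] (N : ℕ) (H : Matrix (Fin N) (Fin N) L)
  [∀ (v : HeightOneSpectrum (𝓞 ↥(maximalRealSubfield L))) (x : (cmDatum L N H).Local v),
    MeasurableSpace ((cmDatum L N H).Local v ⧸ Subgroup.centralizer ({x} : Set ((cmDatum L N H).Local v)))]
  [∀ (v : HeightOneSpectrum (𝓞 ↥(maximalRealSubfield L))) (x : (cmDatum L N H).Local v),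
    BorelSpace ((cmDatum L N H).Local v ⧸ Subgroup.centralizer ({x} : Set ((cmDatum L N H).Local v)))]
  (mG : ∀ v : HeightOneSpectrum (𝓞 ↥(maximalRealSubfield L)), OrbitalMeasureFamily ((cmDatum L N H).Local v))

/-- **At almost every place the unramified orbital integral is the mass of the `K_v`-orbit of the base point**, for ANY rational `γ` whose
a.e. orbit set is `⊆ K_v · Z(γ_v)` (binder (OS)) and ANY local class-indexed families `mG v` invariant at `[γ_v]`:
`Φ_v([γ_v], 1_{K_v}) = ((mG v).atPoint γ_v (π K_v)).toReal` a.e. (`γ_v ∈ K_v` a.e. by ★ `eventually_toLocal_mem_cmLocalIntegralLevel`; ★ §1 of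
`UnramifiedOrbitalUnitFactor` at the point, ★ `orbitalIntegral_atPoint` to the class).  Twin of ★ `eventually_classOrbitalIntegral_indicator_eq_atPoint`
without `IsRegularElt`. [cite: Kottwitz1986, Prop. 7.1] [cite: Rogawski1990, §4.3 p. 44] -/
theorem eventually_classOrbitalIntegral_indicator_eq_atPoint_of_orbitSet (γ : (cmDatum L N H).Rational)
    (hOγ : ∀ᶠ v : HeightOneSpectrum (𝓞 ↥(maximalRealSubfield L)) in Filter.cofinite,
      ∀ y : (cmDatum L N H).Local v,
        y * (cmDatum L N H).toLocal v ((cmDatum L N H).toAdelic γ) * y⁻¹ ∈ cmLocalIntegralLevel L N H v →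
          y ∈ (cmLocalIntegralLevel L N H v : Set ((cmDatum L N H).Local v)) *
            (Subgroup.centralizer ({(cmDatum L N H).toLocal v ((cmDatum L N H).toAdelic γ)} : Set ((cmDatum L N H).Local v)) :
              Set ((cmDatum L N H).Local v)))
    (hinv : ∀ v, SMulInvariantMeasure ((cmDatum L N H).Local v) _
      (mG v (ConjClasses.mk ((cmDatum L N H).toLocal v ((cmDatum L N H).toAdelic γ))))) :
    ∀ᶠ v : HeightOneSpectrum (𝓞 ↥(maximalRealSubfield L)) in Filter.cofinite,
      classOrbitalIntegral (mG v) ((cmLocalIntegralLevel L N H v : Set ((cmDatum L N H).Local v)).indicator fun _ => (1 : ℂ))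
          (ConjClasses.mk ((cmDatum L N H).toLocal v ((cmDatum L N H).toAdelic γ))) =
        (((mG v).atPoint ((cmDatum L N H).toLocal v ((cmDatum L N H).toAdelic γ))
          ((QuotientGroup.mk : (cmDatum L N H).Local v → _) '' (cmLocalIntegralLevel L N H v : Set ((cmDatum L N H).Local v)))).toReal : ℂ) := by
  filter_upwards [hOγ, eventually_toLocal_mem_cmLocalIntegralLevel ((cmDatum L N H).toAdelic γ)] with v hv hγv
  haveI := hinv v
  rw [← (mG v).orbitalIntegral_atPoint]
  exact orbitalIntegral_indicator_eq_of_orbitSet _ _ (cmLocalIntegralLevel L N H v) (isCompact_isOpen_cmLocalIntegralLevel L N H v).2 hγv hv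

/-- **`Φ_v([γ_v], 1_{K_v}) = 1` for almost every `v`**, for ANY rational `γ` with binder (OS), local families invariant at `[γ_v]` and NORMALISED at
`toAdelic γ` off `S₀` (★ `IsNormalisedOff`).  Twin of ★ `eventually_classOrbitalIntegral_indicator_eq_one` without `IsRegularElt` — the statement the
singular Euler assembly (CENSUS-O7 v3 K6-δ) consumes. [cite: Rogawski1990, §4.3 p. 44] [cite: Kottwitz1986, Cor. 7.3] -/
theorem eventually_classOrbitalIntegral_indicator_eq_one_of_orbitSet (γ : (cmDatum L N H).Rational)
    (hOγ : ∀ᶠ v : HeightOneSpectrum (𝓞 ↥(maximalRealSubfield L)) in Filter.cofinite,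
      ∀ y : (cmDatum L N H).Local v,
        y * (cmDatum L N H).toLocal v ((cmDatum L N H).toAdelic γ) * y⁻¹ ∈ cmLocalIntegralLevel L N H v →
          y ∈ (cmLocalIntegralLevel L N H v : Set ((cmDatum L N H).Local v)) *
            (Subgroup.centralizer ({(cmDatum L N H).toLocal v ((cmDatum L N H).toAdelic γ)} : Set ((cmDatum L N H).Local v)) :
              Set ((cmDatum L N H).Local v)))
    (hinv : ∀ v, SMulInvariantMeasure ((cmDatum L N H).Local v) _
      (mG v (ConjClasses.mk ((cmDatum L N H).toLocal v ((cmDatum L N H).toAdelic γ)))))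
    {S₀ : Finset (HeightOneSpectrum (𝓞 ↥(maximalRealSubfield L)))} (hS₀ : IsNormalisedOff L N H mG ((cmDatum L N H).toAdelic γ) S₀) :
    ∀ᶠ v : HeightOneSpectrum (𝓞 ↥(maximalRealSubfield L)) in Filter.cofinite,
      classOrbitalIntegral (mG v) ((cmLocalIntegralLevel L N H v : Set ((cmDatum L N H).Local v)).indicator fun _ => (1 : ℂ))
          (ConjClasses.mk ((cmDatum L N H).toLocal v ((cmDatum L N H).toAdelic γ))) = 1 := by
  filter_upwards [eventually_classOrbitalIntegral_indicator_eq_atPoint_of_orbitSet L N H mG γ hOγ hinv, S₀.eventually_cofinite_notMem]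
    with v hv hvS
  rw [hv, hS₀ v hvS, ENNReal.toReal_one, Complex.ofReal_one]

/-- **The hypothesis `hf1` of the orbital Euler product, discharged at ANY rational `γ` with binder (OS)**: for local families invariant at `[γ_v]`
and normalised at `toAdelic γ` off `S₀`, and an UNRAMIFIED pure tensor `T`, there is a finite `S₂ ⊇ T.S` with `Φ_v([γ_v], T.loc v) = 1` for every
`v ∉ S₂`.  Twin of ★ `exists_finset_forall_classOrbitalIntegral_loc_eq_one` without `IsRegularElt`. [cite: Rogawski1990, §4.3 p. 44; §5.4 p. 72] -/
theorem exists_finset_forall_classOrbitalIntegral_loc_eq_one_of_orbitSet (γ : (cmDatum L N H).Rational)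
    (hOγ : ∀ᶠ v : HeightOneSpectrum (𝓞 ↥(maximalRealSubfield L)) in Filter.cofinite,
      ∀ y : (cmDatum L N H).Local v,
        y * (cmDatum L N H).toLocal v ((cmDatum L N H).toAdelic γ) * y⁻¹ ∈ cmLocalIntegralLevel L N H v →
          y ∈ (cmLocalIntegralLevel L N H v : Set ((cmDatum L N H).Local v)) *
            (Subgroup.centralizer ({(cmDatum L N H).toLocal v ((cmDatum L N H).toAdelic γ)} : Set ((cmDatum L N H).Local v)) :
              Set ((cmDatum L N H).Local v)))
    (hinv : ∀ v, SMulInvariantMeasure ((cmDatum L N H).Local v) _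
      (mG v (ConjClasses.mk ((cmDatum L N H).toLocal v ((cmDatum L N H).toAdelic γ)))))
    {S₀ : Finset (HeightOneSpectrum (𝓞 ↥(maximalRealSubfield L)))} (hS₀ : IsNormalisedOff L N H mG ((cmDatum L N H).toAdelic γ) S₀)
    (T : PureTensor L N H) (hT : T.IsUnramified) :
    ∃ S₂ : Finset (HeightOneSpectrum (𝓞 ↥(maximalRealSubfield L))), T.S ⊆ S₂ ∧
      ∀ v, v ∉ S₂ → classOrbitalIntegral (mG v) (T.loc v) (ConjClasses.mk ((cmDatum L N H).toLocal v ((cmDatum L N H).toAdelic γ))) = 1 := by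
  classical
  have h := eventually_classOrbitalIntegral_indicator_eq_one_of_orbitSet L N H mG γ hOγ hinv hS₀
  rw [Filter.eventually_cofinite] at h
  refine ⟨T.S ∪ h.toFinset, Finset.subset_union_left, fun v hv => ?_⟩
  rw [Finset.mem_union, not_or, Set.Finite.mem_toFinset, Set.mem_setOf_eq, not_not] at hv
  rw [hT.loc_eq hv.1]
  exact hv.2

variable [∀ g : (cmDatum L N H).Adelic, MeasurableSpace ((cmDatum L N H).Adelic ⧸ Subgroup.centralizer ({g} : Set (cmDatum L N H).Adelic))]
  [∀ g : (cmDatum L N H).Adelic, BorelSpace ((cmDatum L N H).Adelic ⧸ Subgroup.centralizer ({g} : Set (cmDatum L N H).Adelic))]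
  [∀ a : arch (↥(maximalRealSubfield L)) L (IsCMField.complexConj L) N H,
    MeasurableSpace (arch (↥(maximalRealSubfield L)) L (IsCMField.complexConj L) N H ⧸
      Subgroup.centralizer ({a} : Set (arch (↥(maximalRealSubfield L)) L (IsCMField.complexConj L) N H)))]
  [∀ a : arch (↥(maximalRealSubfield L)) L (IsCMField.complexConj L) N H,
    BorelSpace (arch (↥(maximalRealSubfield L)) L (IsCMField.complexConj L) N H ⧸
      Subgroup.centralizer ({a} : Set (arch (↥(maximalRealSubfield L)) L (IsCMField.complexConj L) N H)))]
  (mGi : OrbitalMeasureFamily (arch (↥(maximalRealSubfield L)) L (IsCMField.complexConj L) N H))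
  (c : ConjClasses (cmDatum L N H).Rational)

/-- **THE ORBITAL EULER PRODUCT AT ANY RATIONAL CLASS WITH NO INTEGRABILITY AND NO UNIT-FACTOR HYPOTHESIS** (`H` anisotropic; the representative
`γ = out c` carrying binder (OS) — in particular at the SINGULAR semisimple classes once K6-α supplies (KC), §4).  Where the local families are admissible
and normalised off `S₀`: for every `IsTest` pure tensor `T = f_∞ ⊗ ⊗_v f_v` there is a finite `S₂ ⊇ T.S` with
`Φ_{ofLocal mG mGi}([γ], T.eval) = Φ_{mGi}([γ_∞], f_∞) · ∏_{v ∈ S₂} Φ_{mG v}([γ_v], f_v)` — ★ `adelicClassOrbitalIntegral_ofLocal_eval_eq_mul_prod_of_isTest`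
with `hf1` supplied by `exists_finset_forall_classOrbitalIntegral_loc_eq_one_of_orbitSet`.  Twin of ★
`exists_finset_adelicClassOrbitalIntegral_ofLocal_eval_eq_mul_prod` without `IsRegularElt`. [cite: Rogawski1990, §5.4 p. 72; §4.3 p. 44]
[cite: Kottwitz1986, Cor. 7.3] -/
theorem exists_finset_adelicClassOrbitalIntegral_ofLocal_eval_eq_mul_prod_of_orbitSet
    (hanis : ∀ x : Fin N → L, hermForm (cmConjRingHom L) H x x = 0 → x = 0)
    (hOc : ∀ᶠ v : HeightOneSpectrum (𝓞 ↥(maximalRealSubfield L)) in Filter.cofinite,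
      ∀ y : (cmDatum L N H).Local v,
        y * (cmDatum L N H).toLocal v ((cmDatum L N H).toAdelic (Quotient.out c)) * y⁻¹ ∈ cmLocalIntegralLevel L N H v →
          y ∈ (cmLocalIntegralLevel L N H v : Set ((cmDatum L N H).Local v)) *
            (Subgroup.centralizer ({(cmDatum L N H).toLocal v ((cmDatum L N H).toAdelic (Quotient.out c))} :
              Set ((cmDatum L N H).Local v)) : Set ((cmDatum L N H).Local v)))
    {S₀ : Finset (HeightOneSpectrum (𝓞 ↥(maximalRealSubfield L)))}
    (hS₀ : IsNormalisedOff L N H mG ((cmDatum L N H).toAdelic (Quotient.out c)) S₀)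
    (hadm : ∀ v, mG v (ConjClasses.mk ((cmDatum L N H).toLocal v ((cmDatum L N H).toAdelic (Quotient.out c)))) ≠ 0 ∧
      SMulInvariantMeasure ((cmDatum L N H).Local v) _ (mG v (ConjClasses.mk ((cmDatum L N H).toLocal v ((cmDatum L N H).toAdelic (Quotient.out c))))) ∧
      IsFiniteMeasureOnCompacts (mG v (ConjClasses.mk ((cmDatum L N H).toLocal v ((cmDatum L N H).toAdelic (Quotient.out c))))))
    (hadmA : mGi (ConjClasses.mk (archPart (↥(maximalRealSubfield L)) L (IsCMField.complexConj L) N H ((cmDatum L N H).toAdelic (Quotient.out c)))) ≠ 0 ∧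
      SMulInvariantMeasure (arch (↥(maximalRealSubfield L)) L (IsCMField.complexConj L) N H) _
        (mGi (ConjClasses.mk (archPart (↥(maximalRealSubfield L)) L (IsCMField.complexConj L) N H ((cmDatum L N H).toAdelic (Quotient.out c))))) ∧
      IsFiniteMeasureOnCompacts (mGi (ConjClasses.mk (archPart (↥(maximalRealSubfield L)) L (IsCMField.complexConj L) N H ((cmDatum L N H).toAdelic (Quotient.out c))))))
    (T : PureTensor L N H) (hT : T.IsTest) :
    ∃ S₂ : Finset (HeightOneSpectrum (𝓞 ↥(maximalRealSubfield L))), T.S ⊆ S₂ ∧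
      adelicClassOrbitalIntegral L N H (AdelicOrbitalMeasureFamily.ofLocal L N H mG mGi) T.eval c =
        classOrbitalIntegral mGi T.arch
            (ConjClasses.mk (archPart (↥(maximalRealSubfield L)) L (IsCMField.complexConj L) N H ((cmDatum L N H).toAdelic (Quotient.out c)))) *
          ∏ v ∈ S₂, classOrbitalIntegral (mG v) (T.loc v) (ConjClasses.mk ((cmDatum L N H).toLocal v ((cmDatum L N H).toAdelic (Quotient.out c)))) := by
  obtain ⟨S₂, hS₂, hf1⟩ := exists_finset_forall_classOrbitalIntegral_loc_eq_one_of_orbitSet L N H mG (Quotient.out c) hOc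
    (fun v => (hadm v).2.1) hS₀ T hT.isUnramified
  exact ⟨S₂, hS₂, adelicClassOrbitalIntegral_ofLocal_eval_eq_mul_prod_of_isTest L N H mG mGi c hanis hS₀ hadm hadmA T hT S₂ hf1⟩

end UnitFactor

/-! ## §4 The same consequences from the a.e. `K_v`-conjugacy (KC) at `γ` — the socket for K6-α's output -/

section IntegralConj

variable (L : Type) [Field L] [NumberField L] [IsCMField L] (N : ℕ) (H : Matrix (Fin N) (Fin N) L)
  [∀ (v : HeightOneSpectrum (𝓞 ↥(maximalRealSubfield L))) (x : (cmDatum L N H).Local v),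
    MeasurableSpace ((cmDatum L N H).Local v ⧸ Subgroup.centralizer ({x} : Set ((cmDatum L N H).Local v)))]
  [∀ (v : HeightOneSpectrum (𝓞 ↥(maximalRealSubfield L))) (x : (cmDatum L N H).Local v),
    BorelSpace ((cmDatum L N H).Local v ⧸ Subgroup.centralizer ({x} : Set ((cmDatum L N H).Local v)))]
  (mG : ∀ v : HeightOneSpectrum (𝓞 ↥(maximalRealSubfield L)), OrbitalMeasureFamily ((cmDatum L N H).Local v))

/-- **a.e. `Φ_v([γ_v], 1_{K_v}) = (mG v).atPoint γ_v (π K_v)` from (KC) at `γ`** (§2 + §3). [cite: Kottwitz1986, Prop. 7.1] [cite: Rogawski1990, §4.3 p. 44] -/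
theorem eventually_classOrbitalIntegral_indicator_eq_atPoint_of_integralConj (γ : (cmDatum L N H).Rational)
    (hKγ : ∀ᶠ v : HeightOneSpectrum (𝓞 ↥(maximalRealSubfield L)) in Filter.cofinite,
      ∀ g' : (cmDatum L N H).Local v, g' ∈ cmLocalIntegralLevel L N H v →
        IsConj (g'.val : GL (Fin N) (LocalRing L v))
          (((cmDatum L N H).toLocal v ((cmDatum L N H).toAdelic γ)).val : GL (Fin N) (LocalRing L v)) →
          ∃ k ∈ cmLocalIntegralLevel L N H v, k * (cmDatum L N H).toLocal v ((cmDatum L N H).toAdelic γ) * k⁻¹ = g')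
    (hinv : ∀ v, SMulInvariantMeasure ((cmDatum L N H).Local v) _
      (mG v (ConjClasses.mk ((cmDatum L N H).toLocal v ((cmDatum L N H).toAdelic γ))))) :
    ∀ᶠ v : HeightOneSpectrum (𝓞 ↥(maximalRealSubfield L)) in Filter.cofinite,
      classOrbitalIntegral (mG v) ((cmLocalIntegralLevel L N H v : Set ((cmDatum L N H).Local v)).indicator fun _ => (1 : ℂ))
          (ConjClasses.mk ((cmDatum L N H).toLocal v ((cmDatum L N H).toAdelic γ))) =
        (((mG v).atPoint ((cmDatum L N H).toLocal v ((cmDatum L N H).toAdelic γ))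
          ((QuotientGroup.mk : (cmDatum L N H).Local v → _) '' (cmLocalIntegralLevel L N H v : Set ((cmDatum L N H).Local v)))).toReal : ℂ) :=
  eventually_classOrbitalIntegral_indicator_eq_atPoint_of_orbitSet L N H mG γ
    (eventually_orbitSet_of_eventually_integralConj L N H γ hKγ) hinv

/-- **a.e. `Φ_v([γ_v], 1_{K_v}) = 1` from (KC) at `γ`** and normalisation off `S₀` — the K6-β head in the K6-α socket shape: the UNRAMIFIED UNIT
FACTORS at a semisimple (possibly singular) rational `γ`, the moment K6-α delivers `hKγ`. [cite: Rogawski1990, §4.3 p. 44] [cite: Kottwitz1986, Cor. 7.3] -/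
theorem eventually_classOrbitalIntegral_indicator_eq_one_of_integralConj (γ : (cmDatum L N H).Rational)
    (hKγ : ∀ᶠ v : HeightOneSpectrum (𝓞 ↥(maximalRealSubfield L)) in Filter.cofinite,
      ∀ g' : (cmDatum L N H).Local v, g' ∈ cmLocalIntegralLevel L N H v →
        IsConj (g'.val : GL (Fin N) (LocalRing L v))
          (((cmDatum L N H).toLocal v ((cmDatum L N H).toAdelic γ)).val : GL (Fin N) (LocalRing L v)) →
          ∃ k ∈ cmLocalIntegralLevel L N H v, k * (cmDatum L N H).toLocal v ((cmDatum L N H).toAdelic γ) * k⁻¹ = g')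
    (hinv : ∀ v, SMulInvariantMeasure ((cmDatum L N H).Local v) _
      (mG v (ConjClasses.mk ((cmDatum L N H).toLocal v ((cmDatum L N H).toAdelic γ)))))
    {S₀ : Finset (HeightOneSpectrum (𝓞 ↥(maximalRealSubfield L)))} (hS₀ : IsNormalisedOff L N H mG ((cmDatum L N H).toAdelic γ) S₀) :
    ∀ᶠ v : HeightOneSpectrum (𝓞 ↥(maximalRealSubfield L)) in Filter.cofinite,
      classOrbitalIntegral (mG v) ((cmLocalIntegralLevel L N H v : Set ((cmDatum L N H).Local v)).indicator fun _ => (1 : ℂ))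
          (ConjClasses.mk ((cmDatum L N H).toLocal v ((cmDatum L N H).toAdelic γ))) = 1 :=
  eventually_classOrbitalIntegral_indicator_eq_one_of_orbitSet L N H mG γ
    (eventually_orbitSet_of_eventually_integralConj L N H γ hKγ) hinv hS₀

/-- **The finite exceptional set `S₂ ⊇ T.S` from (KC) at `γ`** for an unramified pure tensor `T`: `Φ_v([γ_v], T.loc v) = 1` off `S₂`.
[cite: Rogawski1990, §4.3 p. 44; §5.4 p. 72] -/
theorem exists_finset_forall_classOrbitalIntegral_loc_eq_one_of_integralConj (γ : (cmDatum L N H).Rational)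
    (hKγ : ∀ᶠ v : HeightOneSpectrum (𝓞 ↥(maximalRealSubfield L)) in Filter.cofinite,
      ∀ g' : (cmDatum L N H).Local v, g' ∈ cmLocalIntegralLevel L N H v →
        IsConj (g'.val : GL (Fin N) (LocalRing L v))
          (((cmDatum L N H).toLocal v ((cmDatum L N H).toAdelic γ)).val : GL (Fin N) (LocalRing L v)) →
          ∃ k ∈ cmLocalIntegralLevel L N H v, k * (cmDatum L N H).toLocal v ((cmDatum L N H).toAdelic γ) * k⁻¹ = g')
    (hinv : ∀ v, SMulInvariantMeasure ((cmDatum L N H).Local v) _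
      (mG v (ConjClasses.mk ((cmDatum L N H).toLocal v ((cmDatum L N H).toAdelic γ)))))
    {S₀ : Finset (HeightOneSpectrum (𝓞 ↥(maximalRealSubfield L)))} (hS₀ : IsNormalisedOff L N H mG ((cmDatum L N H).toAdelic γ) S₀)
    (T : PureTensor L N H) (hT : T.IsUnramified) :
    ∃ S₂ : Finset (HeightOneSpectrum (𝓞 ↥(maximalRealSubfield L))), T.S ⊆ S₂ ∧
      ∀ v, v ∉ S₂ → classOrbitalIntegral (mG v) (T.loc v) (ConjClasses.mk ((cmDatum L N H).toLocal v ((cmDatum L N H).toAdelic γ))) = 1 :=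
  exists_finset_forall_classOrbitalIntegral_loc_eq_one_of_orbitSet L N H mG γ
    (eventually_orbitSet_of_eventually_integralConj L N H γ hKγ) hinv hS₀ T hT

variable [∀ g : (cmDatum L N H).Adelic, MeasurableSpace ((cmDatum L N H).Adelic ⧸ Subgroup.centralizer ({g} : Set (cmDatum L N H).Adelic))]
  [∀ g : (cmDatum L N H).Adelic, BorelSpace ((cmDatum L N H).Adelic ⧸ Subgroup.centralizer ({g} : Set (cmDatum L N H).Adelic))]
  [∀ a : arch (↥(maximalRealSubfield L)) L (IsCMField.complexConj L) N H,
    MeasurableSpace (arch (↥(maximalRealSubfield L)) L (IsCMField.complexConj L) N H ⧸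
      Subgroup.centralizer ({a} : Set (arch (↥(maximalRealSubfield L)) L (IsCMField.complexConj L) N H)))]
  [∀ a : arch (↥(maximalRealSubfield L)) L (IsCMField.complexConj L) N H,
    BorelSpace (arch (↥(maximalRealSubfield L)) L (IsCMField.complexConj L) N H ⧸
      Subgroup.centralizer ({a} : Set (arch (↥(maximalRealSubfield L)) L (IsCMField.complexConj L) N H)))]
  (mGi : OrbitalMeasureFamily (arch (↥(maximalRealSubfield L)) L (IsCMField.complexConj L) N H))
  (c : ConjClasses (cmDatum L N H).Rational)

/-- **The `hf1`-free orbital Euler product at ANY rational class from (KC) at its representative** (`H` anisotropic) — the form the singular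
elliptic terms of the stabilised trace formula consume (CENSUS-O7 v3 K6-δ). [cite: Rogawski1990, §5.4 p. 72; §4.3 p. 44] [cite: Kottwitz1986, Cor. 7.3] -/
theorem exists_finset_adelicClassOrbitalIntegral_ofLocal_eval_eq_mul_prod_of_integralConj
    (hanis : ∀ x : Fin N → L, hermForm (cmConjRingHom L) H x x = 0 → x = 0)
    (hKc : ∀ᶠ v : HeightOneSpectrum (𝓞 ↥(maximalRealSubfield L)) in Filter.cofinite,
      ∀ g' : (cmDatum L N H).Local v, g' ∈ cmLocalIntegralLevel L N H v →
        IsConj (g'.val : GL (Fin N) (LocalRing L v))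
          (((cmDatum L N H).toLocal v ((cmDatum L N H).toAdelic (Quotient.out c))).val : GL (Fin N) (LocalRing L v)) →
          ∃ k ∈ cmLocalIntegralLevel L N H v,
            k * (cmDatum L N H).toLocal v ((cmDatum L N H).toAdelic (Quotient.out c)) * k⁻¹ = g')
    {S₀ : Finset (HeightOneSpectrum (𝓞 ↥(maximalRealSubfield L)))}
    (hS₀ : IsNormalisedOff L N H mG ((cmDatum L N H).toAdelic (Quotient.out c)) S₀)
    (hadm : ∀ v, mG v (ConjClasses.mk ((cmDatum L N H).toLocal v ((cmDatum L N H).toAdelic (Quotient.out c)))) ≠ 0 ∧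
      SMulInvariantMeasure ((cmDatum L N H).Local v) _ (mG v (ConjClasses.mk ((cmDatum L N H).toLocal v ((cmDatum L N H).toAdelic (Quotient.out c))))) ∧
      IsFiniteMeasureOnCompacts (mG v (ConjClasses.mk ((cmDatum L N H).toLocal v ((cmDatum L N H).toAdelic (Quotient.out c))))))
    (hadmA : mGi (ConjClasses.mk (archPart (↥(maximalRealSubfield L)) L (IsCMField.complexConj L) N H ((cmDatum L N H).toAdelic (Quotient.out c)))) ≠ 0 ∧
      SMulInvariantMeasure (arch (↥(maximalRealSubfield L)) L (IsCMField.complexConj L) N H) _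
        (mGi (ConjClasses.mk (archPart (↥(maximalRealSubfield L)) L (IsCMField.complexConj L) N H ((cmDatum L N H).toAdelic (Quotient.out c))))) ∧
      IsFiniteMeasureOnCompacts (mGi (ConjClasses.mk (archPart (↥(maximalRealSubfield L)) L (IsCMField.complexConj L) N H ((cmDatum L N H).toAdelic (Quotient.out c))))))
    (T : PureTensor L N H) (hT : T.IsTest) :
    ∃ S₂ : Finset (HeightOneSpectrum (𝓞 ↥(maximalRealSubfield L))), T.S ⊆ S₂ ∧
      adelicClassOrbitalIntegral L N H (AdelicOrbitalMeasureFamily.ofLocal L N H mG mGi) T.eval c =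
        classOrbitalIntegral mGi T.arch
            (ConjClasses.mk (archPart (↥(maximalRealSubfield L)) L (IsCMField.complexConj L) N H ((cmDatum L N H).toAdelic (Quotient.out c)))) *
          ∏ v ∈ S₂, classOrbitalIntegral (mG v) (T.loc v) (ConjClasses.mk ((cmDatum L N H).toLocal v ((cmDatum L N H).toAdelic (Quotient.out c)))) :=
  exists_finset_adelicClassOrbitalIntegral_ofLocal_eval_eq_mul_prod_of_orbitSet L N H mG mGi c hanis
    (eventually_orbitSet_of_eventually_integralConj L N H (Quotient.out c) hKc) hS₀ hadm hadmA T hT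

end IntegralConj

/-! ## §5 Consistency check: (KC) is inhabited today at every REGULAR `γ` (★ `eventually_forall_integralConj_cmDatum`) -/

section Regular

variable (L : Type) [Field L] [NumberField L] [IsCMField L] (N : ℕ) (H : Matrix (Fin N) (Fin N) L)

/-- **(KC) at a REGULAR rational `γ`, for hermitian `H` with `det H ≠ 0`** — ★ `Rogawski1990.eventually_forall_integralConj_cmDatum` (Kottwitz's
Prop. 7.1 in the characteristic-polynomial form, ★ F1 ∕ F2-c) read through «conjugate ⇒ equal characteristic polynomials» (Mathlib
`Matrix.charpoly_units_conj`).  So every theorem of §4 applies today at the regular classes (and §2 ∘ this = ★ `unramifiedOrbitSetAE_of_hermitian`,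
not restated), and the binder (KC) is the exact currency in which K6-α extends Prop. 7.1 to the singular semisimple classes. [cite: Kottwitz1986, Prop. 7.1] [cite: Rogawski1990, §3.3 p. 21] -/
theorem eventually_integralConj_of_isRegularElt (hH : (H.map (cmConjRingHom L))ᵀ = H) (hHd : H.det ≠ 0)
    (γ : (cmDatum L N H).Rational) (hγ : IsRegularElt (γ.val : GL (Fin N) L)) :
    ∀ᶠ v : HeightOneSpectrum (𝓞 ↥(maximalRealSubfield L)) in Filter.cofinite,
      ∀ g' : (cmDatum L N H).Local v, g' ∈ cmLocalIntegralLevel L N H v →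
        IsConj (g'.val : GL (Fin N) (LocalRing L v))
          (((cmDatum L N H).toLocal v ((cmDatum L N H).toAdelic γ)).val : GL (Fin N) (LocalRing L v)) →
          ∃ k ∈ cmLocalIntegralLevel L N H v, k * (cmDatum L N H).toLocal v ((cmDatum L N H).toAdelic γ) * k⁻¹ = g' := by
  filter_upwards [eventually_forall_integralConj_cmDatum L N H hH hHd γ hγ] with v hv g' hg' hc
  refine hv g' hg' ?_
  obtain ⟨y, hy⟩ := isConj_iff.1 hc
  rw [← hy, Units.val_mul, Units.val_mul, Matrix.coe_units_inv, Matrix.charpoly_units_conj]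

end Regular

end UnitaryGroup

end Literature.NumberTheory.Automorphic

end
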